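import Summits.ResolutionOfSingularities.ResolutionOfSingularities.Theorems.FrobeniusClosingSteerStrippedThreadChainCPS
import Summits.ResolutionOfSingularities.ResolutionOfSingularities.Theorems.FrobeniusClosingSteerThreadFinitelyHit
import Mathlib.Data.Nat.Nth
import HarnessLib

/-!
# Stripped threads, part 4H: the thread-level Θ1♭ in the K♭ v2.2 currency (member binder H `HasCleaningDerivations`)

W4.1, crux `Steer` (stmt-ResolutionOfSingularities-16345), σ-line, §σ2.25 v2.1 piece F-A3 `StrippedThreadTwoN` (Θ1♭, res-L0-w41-plan-1
RULING 36; owner res-D-pv-003; consult res-D-pv-011 AS res-L0-w41-stub-7). Theses-free, def-free. This is the thread-level wrapper of the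
engine in continuation form `StrippedThread.strippedChain_of_thread_cps` (part 3c), the H-twin of part 4 (p525514), in the binder shapes of pv-011's T-i wrapper
`ThreadChain.exists_not_noEternalChain_of_finitelyHit` (…ThreadFinitelyHit; §§A–E of the proof below are that file's, verbatim):
the forest words parametric (`Pos`, `Anc` = bodies of `IsPosStep` / `IsAncestorStep`), σ-data at the positive centres (`hvis`: prime,
multiplicity clause, minimality among singular primes, AND — new — the centre is itself a singular prime with regular quotient, all four
from `IsPermissibleCentre`), heights not growing up the tower (`hheight`, res-type-096 p516898), the thread `J` of height `≥ 2`, FINITELY hit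
in height `≥ 2` (`hfin2` = body of `IsFinitelyHitTwo`) but INFINITELY hit (`hinfhit` = body of `¬ IsFinitelyHit`), and the cleaner-descent
principle `hCD` (res-L0-w41-stub-4's (L2) lemma by name in the skeleton leaf; RULING 74), and — NEW — a GERM-LEVEL H (`hH`: every local ring
`(R i)_Q ⊆ K` of a member at a prime has enough cleaning derivations for all `f, g`; in the leaf: (L7) res-D-pv-004 + res-type-096's
`GeoDict.essFiniteType_of_locChar`). Conclusion: `∃ c, 2 ≤ c ∧ c < n ∧ ¬ ⟨NoEternalStrippedRadicandChainH p c body⟩` (K♭ v2.2 = v2.1 + the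
member binder `HasCleaningDerivations p (S m) (f m) (g m)`, body inlined; res-L0-w41-strat-2 §σ2.26 v2, plan-1 RULING 90 (ii)). Proof: thread primes `W m`, SATURATION `V = {m | P m = W m}` (pv-011), restart the visits
beyond `hfin2`'s stage `m₀`; then every hit off the visits has height `< 2` (it is a hit of `J` in strat-2's sense: an ancestor of a visit
would be a saturated stage), is positive hence a singular prime of height `≤ 1` with regular quotient irrelevant; hits recur (`hinfhit`, and a
hit is never a saturated stage); the engine does the rest. OURS (the W4.1 engine). [cite: Cutkosky2014, §2.1] [cite: Matsumura1987, Thm. 15.5]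
-/

noncomputable section

-- `Summit.<S>.<S>.…` duplicates the summit name by design (single-problem summit).
set_option linter.dupNamespace false

open Polynomial IsLocalRing Literature.AlgebraicGeometry.Resolution

namespace Summit.ResolutionOfSingularities.ResolutionOfSingularities.Theorems.SwitchingDichotomy.StrippedThread

section Thread

variable {k : Type} {K : Type} [Field k] [Field K] [Algebra k K]

/-- **Θ1♭ at thread level, K♭ v2.2 currency — the stripped chain also carries H.** See the module docstring. OURS (W4.1 engine; §σ2.26 v2 F-A3).
[cite: Cutkosky2014, §2.1] [cite: Matsumura1987, Thm. 15.5, Thm. 19.3] -/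
theorem exists_not_noEternalStrippedChainH_of_infinitelyHit (p : ℕ) [hp : Fact p.Prime] [CharP K p]
    (O : ValuationSubring K) (A₀ : Subalgebra k K) (h₀ : A₀.toSubring ≤ O.toSubring) (hfg : A₀.FG)
    (R : ℕ → Subring K) (P : (i : ℕ) → Ideal (R i)) (s : ℕ → K) (n : ℕ)
    (hR0 : R 0 = locAtCentre A₀.toSubring O)
    (hbl : ∀ i, IsLocalBlowupAlong O (R i) (P i) (R (i + 1)))
    (hst : ∀ i, ∃ x g : K, ((∃ hx : x ∈ R i, (⟨x, hx⟩ : R i) ∈ P i) ∧ x ≠ 0 ∧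
      ∀ y : R i, y ∈ P i → O.valuation (y : K) ≤ O.valuation x) ∧ g ∈ R i ∧ s i = x * s (i + 1) + g)
    (hsp : ∀ i, s i ^ p ∈ R i)
    (hregR : ∀ i, IsRegularLocalRing (R i))
    (hdim : ∀ i, ringKrullDim (R i) = n)
    (hheight : ∀ i m (hle : R i ≤ R m) (Q : Ideal (R m)) [Q.IsPrime],
      Q.height ≤ (Q.comap (Subring.inclusion hle)).height)
    (hvis : ∀ i, (∃ _ : IsLocalRing (R i), P i ≠ maximalIdeal (R i)) →
      (P i).IsPrime ∧ (∃ g : R i, (⟨s i ^ p, hsp i⟩ : R i) - g ^ p ∈ P i ^ p) ∧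
      (∀ (Q : Ideal (R i)) [Q.IsPrime], Q < P i →
        IsRegularLocalRing (AdjoinRoot ((X : (Localization.AtPrime Q)[X]) ^ p -
          C (algebraMap (R i) (Localization.AtPrime Q) ⟨s i ^ p, hsp i⟩)))) ∧
      (∀ _ : (P i).IsPrime, ¬ IsRegularLocalRing (AdjoinRoot ((X : (Localization.AtPrime (P i))[X]) ^ p -
          C (algebraMap (R i) (Localization.AtPrime (P i)) ⟨s i ^ p, hsp i⟩)))) ∧
      IsRegularLocalRing (R i ⧸ P i))
    (Pos : ℕ → Prop) (hPos : ∀ i, Pos i ↔ ∃ _ : IsLocalRing (R i), P i ≠ maximalIdeal (R i))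
    (Anc : ℕ → ℕ → Prop) (hAnc : ∀ i j, Anc i j ↔ i < j ∧ Pos i ∧ Pos j ∧ (P j).height = (P i).height ∧
      ∃ h : R i ≤ R j, (P j).comap (Subring.inclusion h) = P i)
    (J : Set ℕ) (hJ : J.Infinite) (hJA : ∀ i ∈ J, ∀ j ∈ J, i < j → Anc i j)
    (hJ2 : ∀ i ∈ J, 2 ≤ (P i).height)
    (hfin2 : ∃ m₀ : ℕ, ∀ m, m₀ ≤ m → m ∉ J → ∀ l ∈ J,
      ¬ ((m < l ∧ ¬ Anc m l ∧ ∃ h : R m ≤ R l, P m ≤ (P l).comap (Subring.inclusion h)) ∧ 2 ≤ (P m).height))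
    (hinfhit : ∀ m₀ : ℕ, ∃ m, m₀ ≤ m ∧ m ∉ J ∧ ∃ l ∈ J,
      m < l ∧ ¬ Anc m l ∧ ∃ h : R m ≤ R l, P m ≤ (P l).comap (Subring.inclusion h))
    (hCD : ∀ (S S' : Subring K) [IsRegularLocalRing S] [IsRegularLocalRing S'] (hle : S ≤ S'),
      IsQuadraticTransform S S' → ∀ (ξ : K) (hξ : ξ ∈ S'),
      Ideal.span ((fun y : S => (⟨(y : K), hle y.2⟩ : S')) '' (maximalIdeal S : Set S)) = Ideal.span {(⟨ξ, hξ⟩ : S')} →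
      ∀ (f G F : K), f ∈ S → G ∈ S' → F ∈ S' → ∀ e : ℕ, 1 ≤ e → f - G ^ p = ξ ^ (p * e) * F →
      ∃ g h : K, g ∈ S ∧ h ∈ S' ∧ G = g + ξ ^ e * h)
    (hH : ∀ (i : ℕ) (Q : Ideal (R i)) [Q.IsPrime] (S : Subring K) [IsLocalRing S],
      (∀ z : K, z ∈ S ↔ ∃ a b : R i, b ∉ Q ∧ z = (a : K) / b) → ∀ f g : S,
      (∀ N : ℕ, (∀ h : S, f - h ^ p ∉ maximalIdeal S ^ (N + 1)) → f - g ^ p ∈ maximalIdeal S ^ N →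
        ∃ D : Derivation ℤ S S, D f ∉ maximalIdeal S ^ N ∨
          ((∀ y ∈ maximalIdeal S, D y ∈ maximalIdeal S) ∧ D f ∉ maximalIdeal S ^ (N + 1)))) :
    ∃ c : ℕ, 2 ≤ c ∧ c < n ∧ (∀ i ∈ J, (P i).height = c) ∧
      ¬ (∀ (L : Type) [Field L] [CharP L p] (S : ℕ → Subring L) [∀ m, IsLocalRing (S m)]
        (hle : ∀ m, S m ≤ S (m + 1)) (f g : ∀ m, S m) (x : ∀ m, S (m + 1)) (e : ℕ → ℕ) (_he : ∀ m, 1 ≤ e m)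
        (_hinf : ∀ m₀, ∃ m, m₀ ≤ m ∧ 2 ≤ e m),
        (∀ m, IsRegularLocalRing (S m)) → (∀ m, IsExcellentRing (S m)) → (∀ m, ringKrullDim (S m) = c) →
        (∀ m, IsQuadraticTransform (S m) (S (m + 1))) →
        (∀ m, Ideal.span ((fun y : S m => (⟨(y : L), hle m y.2⟩ : S (m + 1))) '' (maximalIdeal (S m) : Set (S m)))
            = Ideal.span {x m}) →
        (∀ m, ((f (m + 1) : S (m + 1)) : L) * ((x m : S (m + 1)) : L) ^ (p * e m) =
            ((f m : S m) : L) - ((g m : S m) : L) ^ p) →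
        (∀ m, ∃ h : S m, f m - h ^ p ∈ maximalIdeal (S m) ^ p) →
        (∀ m, ∀ N : ℕ, (∀ h : S m, f m - h ^ p ∉ maximalIdeal (S m) ^ (N + 1)) →
          f m - (g m) ^ p ∈ maximalIdeal (S m) ^ N →
          ∃ D : Derivation ℤ (S m) (S m), D (f m) ∉ maximalIdeal (S m) ^ N ∨
            ((∀ y ∈ maximalIdeal (S m), D y ∈ maximalIdeal (S m)) ∧ D (f m) ∉ maximalIdeal (S m) ^ (N + 1))) →
        (∀ m, ∀ (Q : Ideal (AdjoinRoot ((X : (S m)[X]) ^ p - C (f m)))) [Q.IsPrime],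
            (∃ Q' : Ideal (AdjoinRoot ((X : (S m)[X]) ^ p - C (f m))), Q'.IsPrime ∧ Q < Q') →
            IsRegularLocalRing (Localization.AtPrime Q)) →
        False) := by
  classical
  -- ### generalities on the tower
  have hmono : Monotone R := monotone_nat_of_le_succ fun i => (hbl i).isLocalBlowup.le
  haveI hloc : ∀ i, IsLocalRing (R i) := fun i => by haveI := hregR i; infer_instance
  -- transitivity of `Anc` and the chain property (strat-2's `isAncestorStep_trans` / `_of_common_descendant`, bodies)
  have hAtrans : ∀ {i j l}, Anc i j → Anc j l → Anc i l := by
    intro i j l h₁ h₂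
    obtain ⟨hij, hpi, -, hh₁, e₁, hc₁⟩ := (hAnc i j).mp h₁
    obtain ⟨hjl, -, hpl, hh₂, e₂, hc₂⟩ := (hAnc j l).mp h₂
    refine (hAnc i l).mpr ⟨hij.trans hjl, hpi, hpl, hh₂.trans hh₁, e₁.trans e₂, ?_⟩
    have hcomp : Subring.inclusion (e₁.trans e₂) = (Subring.inclusion e₂).comp (Subring.inclusion e₁) :=
      RingHom.ext fun _ => rfl
    rw [hcomp, ← Ideal.comap_comap, hc₂, hc₁]
  have hAchain : ∀ {i j l}, i < j → Anc i l → Anc j l → Anc i j := by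
    intro i j l hij h₁ h₂
    obtain ⟨-, hpi, -, hh₁, e₁, hc₁⟩ := (hAnc i l).mp h₁
    obtain ⟨-, hpj, -, hh₂, e₂, hc₂⟩ := (hAnc j l).mp h₂
    refine (hAnc i j).mpr ⟨hij, hpi, hpj, hh₂.symm.trans hh₁, hmono hij.le, ?_⟩
    have hcomp : Subring.inclusion e₁ = (Subring.inclusion e₂).comp (Subring.inclusion (hmono hij.le)) :=
      RingHom.ext fun _ => rfl
    rw [← hc₁, hcomp, ← Ideal.comap_comap, hc₂]
  -- comaps along the tower compose, and do not depend on the inclusion proof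
  have hcomap_tr : ∀ {a b d : ℕ} (hab : a ≤ b) (hbd : b ≤ d) (Q : Ideal (R d)),
      (Q.comap (Subring.inclusion (hmono (hab.trans hbd)))) =
        (Q.comap (Subring.inclusion (hmono hbd))).comap (Subring.inclusion (hmono hab)) := by
    intro a b d hab hbd Q
    rw [Ideal.comap_comap]
    rfl
  have hcomap_irrel : ∀ {a b : ℕ} (h h' : R a ≤ R b) (Q : Ideal (R b)),
      Q.comap (Subring.inclusion h) = Q.comap (Subring.inclusion h') := fun _ _ _ => rfl
  have hcomap_self : ∀ {a : ℕ} (h : R a ≤ R a) (Q : Ideal (R a)), Q.comap (Subring.inclusion h) = Q := by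
    intro a h Q
    ext y
    rw [Ideal.mem_comap]
    rfl
  -- the maximal ideal has height `n`; positive-dimensional centres have height `< n`
  have hhtmax : ∀ i, (maximalIdeal (R i)).height = n := by
    intro i
    haveI := hregR i
    have h := IsLocalRing.maximalIdeal_height_eq_ringKrullDim (R := R i)
    rw [hdim i] at h
    exact_mod_cast h
  obtain ⟨i₀, hi₀⟩ := hJ.nonempty
  have hpos₀ : ∃ _ : IsLocalRing (R i₀), P i₀ ≠ maximalIdeal (R i₀) := by
    obtain ⟨i₁, hi₁, hlt⟩ := hJ.exists_gt i₀
    exact (hPos i₀).mp ((hAnc i₀ i₁).mp (hJA i₀ hi₀ i₁ hi₁ hlt)).2.1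
  haveI : (P i₀).IsPrime := (hvis i₀ hpos₀).1
  obtain ⟨c, hc'⟩ := ENat.ne_top_iff_exists.mp ((P i₀).height_ne_top Ideal.IsPrime.ne_top')
  have hc : (P i₀).height = c := hc'.symm
  have hJc : ∀ i ∈ J, (P i).height = c := by
    intro i hi
    rcases lt_trichotomy i i₀ with h | rfl | h
    · rw [← ((hAnc i i₀).mp (hJA i hi i₀ hi₀ h)).2.2.2.1]; exact hc
    · exact hc
    · rw [((hAnc i₀ i).mp (hJA i₀ hi₀ i hi h)).2.2.2.1]; exact hc
  -- ### A. enumerate the thread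
  have hjmono : StrictMono (Nat.nth (· ∈ J)) := Nat.nth_strictMono hJ
  set j : ℕ → ℕ := Nat.nth (· ∈ J) with hjdef
  have hjmem : ∀ k, j k ∈ J := fun k => Nat.nth_mem_of_infinite hJ k
  have hjle : ∀ k, k ≤ j k := fun k => hjmono.id_le k
  have hjA : ∀ {k l}, k < l → Anc (j k) (j l) := fun {k l} h => hJA _ (hjmem k) _ (hjmem l) (hjmono h)
  have hjpos : ∀ k, ∃ _ : IsLocalRing (R (j k)), P (j k) ≠ maximalIdeal (R (j k)) := fun k =>
    (hPos _).mp ((hAnc _ _).mp (hjA (Nat.lt_succ_self k))).2.1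
  haveI hjprime : ∀ k, (P (j k)).IsPrime := fun k => (hvis _ (hjpos k)).1
  have hjht : ∀ k, (P (j k)).height = c := fun k => hJc _ (hjmem k)
  have hjP : ∀ {k l} (h : k ≤ l), (P (j l)).comap (Subring.inclusion (hmono (hjmono.monotone h))) = P (j k) := by
    intro k l h
    rcases h.eq_or_lt with rfl | h
    · exact hcomap_self _ _
    · obtain ⟨-, -, -, -, e, hc⟩ := (hAnc _ _).mp (hjA h)
      rw [hcomap_irrel _ e]
      exact hc
  -- `c < n`
  have hcn : c < n := by
    obtain ⟨_, hne⟩ := hjpos 0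
    have h1 := Ideal.height_add_one_le_of_lt_of_isPrime
      (lt_of_le_of_ne (IsLocalRing.le_maximalIdeal (hjprime 0).ne_top) hne)
    rw [hjht 0, hhtmax] at h1
    have : (c : ℕ∞) + 1 ≤ n := h1
    exact_mod_cast (ENat.add_one_le_iff (ENat.coe_ne_top c)).mp this
  -- ### B. the next visit `ν m` and the thread primes `W m`
  have hνex : ∀ m, ∃ k, m ≤ j k := fun m => ⟨m, hjle m⟩
  let ν : ℕ → ℕ := fun m => Nat.find (hνex m)
  have hνspec : ∀ m, m ≤ j (ν m) := fun m => Nat.find_spec (hνex m)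
  have hνmin : ∀ m k, m ≤ j k → ν m ≤ k := fun m k h => Nat.find_min' (hνex m) h
  have hνvisit : ∀ k, ν (j k) = k := by
    intro k
    refine le_antisymm (hνmin _ _ le_rfl) ?_
    by_contra h
    push Not at h
    exact absurd (hνspec (j k)) (not_le.mpr (hjmono h))
  have hνmono : ∀ m, ν m ≤ ν (m + 1) := fun m => hνmin _ _ ((Nat.le_succ m).trans (hνspec (m + 1)))
  let W : (m : ℕ) → Ideal (R m) := fun m => (P (j (ν m))).comap (Subring.inclusion (hmono (hνspec m)))
  haveI hWprime : ∀ m, (W m).IsPrime := fun m => Ideal.comap_isPrime _ _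
  -- `W m = P (j l) ∩ R m` for EVERY later visit `l`
  have hWany : ∀ m l (h : m ≤ j l), W m = (P (j l)).comap (Subring.inclusion (hmono h)) := by
    intro m l h
    have hνl : ν m ≤ l := hνmin _ _ h
    change (P (j (ν m))).comap (Subring.inclusion (hmono (hνspec m))) = _
    rw [← hjP hνl, Ideal.comap_comap]
    rfl
  have hWP : ∀ k, W (j k) = P (j k) := by
    intro k
    rw [hWany (j k) k le_rfl]
    exact hcomap_self _ _
  have hWcomap : ∀ m, ∃ h : R m ≤ R (m + 1), (W (m + 1)).comap (Subring.inclusion h) = W m := by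
    intro m
    refine ⟨hmono (Nat.le_succ m), ?_⟩
    rw [hWany (m + 1) (ν (m + 1)) (hνspec _), hWany m (ν (m + 1)) ((Nat.le_succ m).trans (hνspec _)),
      Ideal.comap_comap]
    rfl
  have hWcomap' : ∀ m d, (W (m + d)).comap (Subring.inclusion (hmono (Nat.le_add_right m d))) = W m := by
    intro m d
    rw [hWany (m + d) (ν (m + d)) (hνspec _), hWany m (ν (m + d)) ((Nat.le_add_right m d).trans (hνspec _)),
      Ideal.comap_comap]
    rfl
  -- ### E. every thread prime has height `c`
  have hWht : ∀ m, j 0 ≤ m → (W m).height = c := by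
    intro m hm
    apply le_antisymm
    · have h1 := hheight (j 0) m (hmono hm) (W m)
      obtain ⟨d, rfl⟩ := Nat.exists_eq_add_of_le hm
      rw [hWcomap' (j 0) d, hWP 0, hjht 0] at h1
      exact h1
    · have h1 := hheight m (j (ν m)) (hmono (hνspec m)) (P (j (ν m)))
      rw [hjht] at h1
      exact h1
  have hWne : ∀ m, j 0 ≤ m → W m ≠ maximalIdeal (R m) := by
    intro m hm h
    have h1 := hWht m hm
    rw [h, hhtmax] at h1
    have : n = c := by exact_mod_cast h1
    omega
  have hWpos : ∀ m, j 0 ≤ m → ∀ Q : Ideal (R m), Q ≤ W m → ∃ _ : IsLocalRing (R m), Q ≠ maximalIdeal (R m) :=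
    fun m hm Q hQ => ⟨inferInstance, fun h =>
      hWne m hm (le_antisymm (IsLocalRing.le_maximalIdeal (hWprime m).ne_top) (h ▸ hQ))⟩
  -- ### D. saturate: all stages whose centre IS the thread prime
  set V : Set ℕ := {m | j 0 ≤ m ∧ P m = W m} with hVdef
  have hjV : ∀ k, j k ∈ V := fun k => ⟨hjmono.monotone (Nat.zero_le k), (hWP k).symm⟩
  have hVinf : V.Infinite :=
    (Set.infinite_range_of_injective hjmono.injective).mono (by rintro _ ⟨k, rfl⟩; exact hjV k)
  have hvmono : StrictMono (Nat.nth (· ∈ V)) := Nat.nth_strictMono hVinf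
  set v : ℕ → ℕ := Nat.nth (· ∈ V) with hvdef
  have hvmem : ∀ k, v k ∈ V := fun k => Nat.nth_mem_of_infinite hVinf k
  have hvle : ∀ k, k ≤ v k := fun k => hvmono.id_le k
  have hvsurj : ∀ m ∈ V, ∃ k, v k = m := fun m hm => ⟨Nat.count (· ∈ V) m, Nat.nth_count hm⟩
  have hv0 : ∀ k, j 0 ≤ v k := fun k => (hvmem k).1
  -- ### F. restart beyond `m₀`: every later hit has height `≤ 1`, and hits recur
  obtain ⟨m₀, hm₀⟩ := hfin2
  let j' : ℕ → ℕ := fun k => v (m₀ + k)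
  have hj'mono : StrictMono j' := fun a b h => hvmono (by omega)
  have hj'0 : ∀ k, j 0 ≤ j' k := fun k => hv0 _
  have hm₀j' : ∀ k, m₀ ≤ j' k := fun k => (Nat.le_add_right m₀ k).trans (hvle _)
  have hj'P : ∀ k, W (j' k) = P (j' k) := fun k => (hvmem (m₀ + k)).2.symm
  have hj'pos : ∀ k, ∃ _ : IsLocalRing (R (j' k)), P (j' k) ≠ maximalIdeal (R (j' k)) :=
    fun k => hWpos _ (hj'0 k) _ (hj'P k ▸ le_rfl)
  -- a hit off the visits is NOT a saturated stage, and is a strat-2 hit of the next visit of `J`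
  have hhitJ : ∀ m, j' 0 ≤ m → (∀ k, m ≠ j' k) → P m ≤ W m →
      m ∉ J ∧ (m < j (ν m) ∧ ¬ Anc m (j (ν m)) ∧
        ∃ h : R m ≤ R (j (ν m)), P m ≤ (P (j (ν m))).comap (Subring.inclusion h)) := by
    intro m hm hne hPW
    have hmV : m ∉ V := by
      intro hmV
      obtain ⟨k, hk⟩ := hvsurj m hmV
      have hNk : m₀ ≤ k := by
        by_contra hlt
        rw [not_le] at hlt
        have : v k < v m₀ := hvmono hlt
        have h2 : v m₀ ≤ m := by simpa [j'] using hm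
        omega
      obtain ⟨d, rfl⟩ := Nat.exists_eq_add_of_le hNk
      exact hne d hk.symm
    have hmJ : m ∉ J := fun hmJ => by
      obtain ⟨kk, hkk⟩ : ∃ kk, j kk = m := ⟨Nat.count (· ∈ J) m, Nat.nth_count hmJ⟩
      exact hmV (hkk ▸ hjV kk)
    have hlt : m < j (ν m) := lt_of_le_of_ne (hνspec m) fun h => hmV (h ▸ hjV (ν m))
    refine ⟨hmJ, hlt, fun hanc => hmV ⟨(hj'0 0).trans hm, ?_⟩, hmono hlt.le, ?_⟩
    · obtain ⟨-, -, -, -, e, hc⟩ := (hAnc _ _).mp hanc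
      rw [hWany m (ν m) (hνspec m), hcomap_irrel _ e]
      exact hc.symm
    · rw [← hcomap_irrel (hmono (hνspec m)), ← hWany m (ν m) (hνspec m)]
      exact hPW
  have hhit : ∀ m, j' 0 ≤ m → (∀ k, m ≠ j' k) → P m ≤ W m → ∃ _ : (P m).IsPrime, (P m).height ≤ 1 ∧
      ¬ IsRegularLocalRing (AdjoinRoot ((X : (Localization.AtPrime (P m))[X]) ^ p -
        C (algebraMap (R m) (Localization.AtPrime (P m)) ⟨s m ^ p, hsp m⟩))) := by
    intro m hm hne hPW
    obtain ⟨hmJ, hit⟩ := hhitJ m hm hne hPW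
    obtain ⟨hPm, -, -, hsing, -⟩ := hvis m (hWpos m ((hj'0 0).trans hm) (P m) hPW)
    have h2 : ¬ 2 ≤ (P m).height := fun h2 =>
      hm₀ m ((hm₀j' 0).trans hm) hmJ (j (ν m)) (hjmem _) ⟨hit, h2⟩
    refine ⟨hPm, ?_, hsing hPm⟩
    have : (P m).height < 1 + 1 := not_le.mp h2
    exact Order.le_of_lt_add_one this
  have hinf : ∀ m₁, ∃ m, m₁ ≤ m ∧ (∀ k, m ≠ j' k) ∧ P m ≤ W m := by
    intro m₁
    obtain ⟨m, hm, hmJ, l, hl, hml, hanc, e, hPle⟩ := hinfhit (max m₁ (j 0))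
    have hm1 : m₁ ≤ m := (le_max_left _ _).trans hm
    have hm0 : j 0 ≤ m := (le_max_right _ _).trans hm
    obtain ⟨kk, hkk⟩ : ∃ kk, j kk = l := ⟨Nat.count (· ∈ J) l, Nat.nth_count hl⟩
    have hPW : P m ≤ W m := by
      rw [hWany m kk (hkk ▸ hml.le), hcomap_irrel _ (hkk ▸ e : R m ≤ R (j kk))]
      subst hkk
      exact hPle
    refine ⟨m, hm1, fun k hk => ?_, hPW⟩
    -- a hit is never a saturated stage: it would be an ancestor of `l`
    have hmV : m ∈ V := hk ▸ hvmem (m₀ + k)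
    apply hanc
    subst hkk
    refine (hAnc m (j kk)).mpr ⟨hml, (hPos m).mpr (hWpos m hm0 (P m) hPW), (hPos _).mpr (hjpos kk), ?_, e, ?_⟩
    · rw [hjht, hmV.2]; exact (hWht m hm0).symm
    · rw [hcomap_irrel e (hmono hml.le), ← hWany m kk hml.le]; exact hmV.2.symm
  have h2c : 2 ≤ c := by
    have := hJ2 i₀ hi₀
    rw [hc] at this
    exact_mod_cast this
  refine ⟨c, h2c, hcn, hJc, fun hNo => ?_⟩
  refine strippedChain_of_thread_cps p O A₀ h₀ hfg R P s c hR0 hbl hst hsp hregR j' hj'mono W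
    (fun m _ => hWprime m) hj'P (fun m _ => hWcomap m) hhit hinf
    (fun k => by rw [← hj'P k]; exact hWht _ (hj'0 k))
    (fun k => (hvis _ (hj'pos k)).2.2.2.2)
    (fun k => (hvis _ (hj'pos k)).2.1)
    (fun k Q _ hQ => (hvis _ (hj'pos k)).2.2.1 Q hQ) hCD False ?_
  intro S _ hle f g x e he hinf' hreg hexc hdimS hqt hspan hlaw hmult hiso hloc
  haveI : ∀ k, (P (j' (k + 1))).IsPrime := fun k => (hvis _ (hj'pos (k + 1))).1
  exact hNo K S hle f g x e he hinf' hreg hexc hdimS hqt hspan hlaw hmult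
    (fun m => hH (j' (m + 1)) (P (j' (m + 1))) (S m) (hloc m) (f m) (g m)) hiso

end Thread

end Summit.ResolutionOfSingularities.ResolutionOfSingularities.Theorems.SwitchingDichotomy.StrippedThread

end
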